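import Literature.Probability.RandomPlanarGeometry.PlaneNonIntersectionProofs
import Literature.Probability.LatticeModels.SRWStepSequences
import Mathlib.Data.Nat.Choose.Central
import HarnessLib

/-!
# Non-intersecting pairs of planar walks: the half-plane lower bound `N(k)/16^k ≥ 1/(2(k+1))`

Second proof-only companion to `PlaneNonIntersection.lean` (the named fact
`LSW2001_srw_nonIntersection_five_eighths`, Lawler–Schramm–Werner 2001, §1:
`c⁻¹ k^{-5/8} ≤ P[S[0,k] ∩ S'[0,k] = ∅] ≤ c k^{-5/8}`, with the probability written as
`nonIntersectingPairs k / 16^k`), sequel to `PlaneNonIntersectionProofs.lean` (`0 < N(k) ≤ 16^k`).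

What is PROVED here is the classical elementary LOWER bound with exponent `1` in place of `5/8`
(equivalently: the planar intersection exponent satisfies `ζ₂ ≤ 1`), by the two-half-planes
argument:

* if the walk `S` from `0` stays in the closed half-plane `{x + y ≤ 0}` and the walk `S'` from
  `e₁ = (1,0)` stays in `{x + y ≥ 1}`, the two vertex sets are disjoint;
* along a nearest-neighbour walk of `ℤ²` the diagonal coordinate `x + y` moves by `±1` at every
  step, the sign being the orientation bit of the step and the axis being free: the number of
  `k`-step walks from `0` staying in `{x + y ≤ 0}` is `2^k · b_k`, `b_k` = the number of `±1`
  paths of length `k` with all partial sums `≤ 0` (`card_filter_stepSeq_snd`,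
  `pos_apply_zero_add_pos_apply_one`); the point reflection `x ↦ e₁ - x` (a lattice automorphism,
  `antipode`) carries these walks onto the `k`-step walks from `e₁` staying in `{x + y ≥ 1}`;
* **ballot / reflection principle** (`choose_half_le_card_filter_signSum_le_zero`):
  `b_k ≥ C(k, ⌊k/2⌋)` — a path whose maximum is `≥ 1` but which ends `≤ 0`, reflected after its
  first passage at level `1`, ends at level `≥ 2`, injectively
  (`card_filter_max_pos_and_le_zero_le`), and `#{S_k ≥ 2} = #{S_k ≤ -2}`, so
  `b_k = 2^k - #{max ≥ 1} ≥ #{S_k ∈ {0, -1}} = C(k, ⌊k/2⌋)`;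
* `C(k, ⌊k/2⌋)² · 2(k+1) ≥ 4^k` (`four_pow_le_mul_choose_half_sq`, from
  `16^m ≤ 4m · C(2m,m)²`).

Hence `N(k) ≥ (2^k b_k)² ≥ 4^k C(k,⌊k/2⌋)²` (`four_pow_mul_choose_sq_le_nonIntersectingPairs`),
`16^k ≤ 2(k+1) N(k)` (`sixteen_pow_le`), `1/(2(k+1)) ≤ N(k)/16^k` (`inv_le_nonIntersectingPairs_div`)
and, in the shape of the vendored display, `(1/4) k^{-1} ≤ N(k)/16^k` for `k ≥ 1`
(`exists_const_mul_rpow_neg_one_le`). The exponent `5/8` itself (either half of the display) is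
NOT proved here: it rests on `ξ(1,1) = 5/4` (LSW 2001, Thm. 13, radial `SLE₆`) and on Lawler's
random-walk comparison up to constants (EJP 1:13 (1996), Thm. 1.3), neither of which is in the
tree; see the module docstring of `PlaneNonIntersection.lean`.

Design notes. (1) The walks are handled through the tree's step-sequence coding of the simple
random walk (`Literature.Probability.LatticeModels.SRW.StepSeq`, `pos`, `toWalk`,
`support_toWalk`, `endpoint_mem_box`, `sum_stepVec_apply`; `SRWStepSequences.lean`), so nothing
about `finsetWalkLength` is re-proved; the lower bound needs only two injections into the index
set of `nonIntersectingPairs_eq_card_filter`, not a bijection. (2) `±1` paths are coded by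
`β : Fin k → Bool` with partial sums `signSum β j` frozen after time `k`, and the reflection after
a time is `reflectAfter` (the same device as the planar reflection of
`Literature.Barriers.CriticalPhenomena.Edwards2D.card_filter_exists_normSq_pos_le`, Lévy's
maximal inequality, which lives above this layer and concerns `|ω|²`, not a signed coordinate).
(3) `sixteen_pow_le_four_mul_mul_centralBinom_sq` (`16^m ≤ 4m·C(2m,m)²`) restates in eight
lines `Literature.Barriers.CriticalPhenomena.Edwards2D.sixteen_pow_le_mul_centralBinom_sq`, which
cannot be imported here without inverting the `Barriers → Probability` import direction.

## References

* G. F. Lawler, O. Schramm, W. Werner, *Values of Brownian intersection exponents, II: Plane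
  exponents*, Acta Math. **187** (2001) 275–308, §1 [LawlerSchrammWerner2001PlaneExponents].
* G. F. Lawler, *Intersections of Random Walks*, Birkhäuser 1991, §1.2–1.3 (reflection
  arguments) and Ch. 5 (elementary bounds on intersection exponents) [Lawler1991].
* W. Feller, *An Introduction to Probability Theory and its Applications* I, 3rd ed., Ch. III
  §§1–3 (reflection principle, ballot theorem) [folklore].

Mathlib: `Nat.centralBinom`, `Nat.succ_mul_centralBinom_succ`, `Nat.choose_symm_half`,
`Finset.card_powersetCard`, `Finset.card_nbij'`, `Finset.card_equiv`,
`Equiv.arrowProdEquivProdArrow`, `Finset.card_le_card_of_injOn`, `SimpleGraph.Walk.map`,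
`SimpleGraph.Walk.support_map`, `List.map_inj_left`.
-/

noncomputable section

open Finset SimpleGraph Literature.Probability.LatticeModels Literature.Probability.LatticeModels.SRW
open scoped BigOperators

namespace Literature.Probability.RandomPlanarGeometry

namespace PlaneNonIntersection

/-! ### `±1` paths of length `k` coded by Boolean step sequences -/

section SignedPaths

variable {k : ℕ}

/-- The partial sums `S_β(j) = Σ_{i<j} (±1)` (`+1` for `true`, `-1` for `false`) of a Boolean
step sequence `β : Fin k → Bool` — the simple `±1` walk on `ℤ` coded by its steps — frozen at
`S_β(k)` for `j ≥ k`. [folklore] -/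
def signSum (β : Fin k → Bool) (j : ℕ) : ℤ :=
  ∑ i : Fin k, if (i : ℕ) < j then (if β i then 1 else -1) else 0

/-- `S_β(0) = 0`. [folklore] -/
@[simp] theorem signSum_zero (β : Fin k → Bool) : signSum β 0 = 0 := by
  simp [signSum]

/-- One more step: `S_β(j+1) = S_β(j) ± 1` for `j < k`. [folklore] -/
theorem signSum_succ (β : Fin k → Bool) {j : ℕ} (hj : j < k) :
    signSum β (j + 1) = signSum β j + (if β ⟨j, hj⟩ then 1 else -1) := by
  unfold signSum
  rw [← sub_eq_iff_eq_add', ← Finset.sum_sub_distrib, Finset.sum_eq_single ⟨j, hj⟩]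
  · simp
  · intro i _ hi
    have hij : (i : ℕ) ≠ j := fun h => hi (Fin.ext h)
    by_cases h1 : (i : ℕ) < j
    · have h2 : (i : ℕ) < j + 1 := by omega
      simp [h1, h2]
    · have h2 : ¬ (i : ℕ) < j + 1 := by omega
      simp [h1, h2]
  · simp

/-- The partial sums are frozen after time `k`. [folklore] -/
theorem signSum_of_le (β : Fin k → Bool) {j : ℕ} (hj : k ≤ j) : signSum β j = signSum β k := by
  unfold signSum
  refine Finset.sum_congr rfl fun i _ => ?_
  simp [lt_of_lt_of_le i.isLt hj, i.isLt]

/-- A step raises the partial sum by at most one. [folklore] -/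
theorem signSum_succ_le (β : Fin k → Bool) (j : ℕ) : signSum β (j + 1) ≤ signSum β j + 1 := by
  by_cases hj : j < k
  · rw [signSum_succ β hj]
    split_ifs <;> omega
  · rw [signSum_of_le β (show k ≤ j + 1 by omega), signSum_of_le β (not_lt.1 hj)]
    omega

/-- The final value in terms of the number `t` of up-steps: `S_β(k) = 2t - k`. [folklore] -/
theorem signSum_self_eq (β : Fin k → Bool) :
    signSum β k = 2 * ((Finset.univ.filter fun i => β i = true).card : ℤ) - k := by
  unfold signSum
  calc ∑ i : Fin k, (if (i : ℕ) < k then (if β i then (1 : ℤ) else -1) else 0)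
      = ∑ i : Fin k, (2 * (if β i = true then (1 : ℤ) else 0) - 1) :=
        Finset.sum_congr rfl fun i _ => by
          rw [if_pos i.isLt]
          cases β i <;> norm_num
    _ = 2 * ((Finset.univ.filter fun i => β i = true).card : ℤ) - k := by
        rw [Finset.sum_sub_distrib, ← Finset.mul_sum, Finset.sum_boole]
        simp

/-- Negating every step negates the partial sums. [folklore] -/
theorem signSum_not (β : Fin k → Bool) (j : ℕ) : signSum (fun i => !β i) j = -signSum β j := by
  unfold signSum
  rw [← Finset.sum_neg_distrib]
  refine Finset.sum_congr rfl fun i _ => ?_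
  by_cases h : (i : ℕ) < j <;> cases hb : β i <;> simp [h, hb]

/-- **Reflection after time `τ`**: the steps with index `≥ τ` are negated. [folklore] -/
def reflectAfter (β : Fin k → Bool) (τ : ℕ) : Fin k → Bool :=
  fun i => if (i : ℕ) < τ then β i else !β i

/-- Reflecting twice after the same time gives the path back. [folklore] -/
theorem reflectAfter_reflectAfter (β : Fin k → Bool) (τ : ℕ) :
    reflectAfter (reflectAfter β τ) τ = β := by
  funext i
  by_cases h : (i : ℕ) < τ <;> simp [reflectAfter, h]

/-- Up to the reflection time nothing changes. [folklore] -/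
theorem signSum_reflectAfter_of_le (β : Fin k → Bool) {τ j : ℕ} (hj : j ≤ τ) :
    signSum (reflectAfter β τ) j = signSum β j := by
  unfold signSum reflectAfter
  refine Finset.sum_congr rfl fun i _ => ?_
  by_cases hi : (i : ℕ) < j
  · simp [hi, lt_of_lt_of_le hi hj]
  · simp [hi]

/-- After the reflection time the path is reflected through its value at `τ`:
`S̃(j) + S(j) = 2 S(τ)` for `j ≥ τ`. [folklore] -/
theorem signSum_reflectAfter_add (β : Fin k → Bool) {τ j : ℕ} (hj : τ ≤ j) :
    signSum (reflectAfter β τ) j + signSum β j = 2 * signSum β τ := by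
  unfold signSum reflectAfter
  rw [← Finset.sum_add_distrib, Finset.mul_sum]
  refine Finset.sum_congr rfl fun i _ => ?_
  by_cases hi : (i : ℕ) < τ
  · simp only [if_pos hi, if_pos (lt_of_lt_of_le hi hj)]
    split_ifs <;> norm_num
  · by_cases hij : (i : ℕ) < j
    · simp only [if_neg hi, if_pos hij, mul_zero]
      cases β i <;> simp
    · simp [hi, hij]

open Classical in
/-- **Reflection principle (injective half).** The `±1` paths of length `k` whose maximum is
`≥ 1` but which end at a level `≤ 0` are no more than the paths ending at a level `≥ 2`:
reflecting such a path after its first passage time `τ` at level `1` (where `S(τ) = 1`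
exactly, the steps being `±1`) gives a path ending at `2 - S(k) ≥ 2`, and the map is injective
because the reflected path has the same first passage time and the reflection is an
involution. [folklore] -/
theorem card_filter_max_pos_and_le_zero_le (k : ℕ) :
    #{β : Fin k → Bool | (∃ j ≤ k, 0 < signSum β j) ∧ signSum β k ≤ 0} ≤
      #{β : Fin k → Bool | 2 ≤ signSum β k} := by
  set A : Finset (Fin k → Bool) := {β | (∃ j ≤ k, 0 < signSum β j) ∧ signSum β k ≤ 0} with hA
  set B : Finset (Fin k → Bool) := {β | 2 ≤ signSum β k} with hB
  have hmemA : ∀ β, β ∈ A ↔ (∃ j ≤ k, 0 < signSum β j) ∧ signSum β k ≤ 0 := fun β => by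
    simp [hA]
  have hex : ∀ β ∈ A, ∃ j, 0 < signSum β j := fun β hβ => by
    obtain ⟨⟨j, -, hj⟩, -⟩ := (hmemA β).1 hβ
    exact ⟨j, hj⟩
  -- the first passage time at level `1`
  let τ : (Fin k → Bool) → ℕ := fun β => if h : β ∈ A then Nat.find (hex β h) else 0
  have hτ : ∀ β ∈ A, signSum β (τ β) = 1 ∧ ∀ j < τ β, signSum β j ≤ 0 := by
    intro β hβ
    have hspec : 0 < signSum β (τ β) := by
      simpa [τ, hβ] using Nat.find_spec (hex β hβ)
    have hmin : ∀ j < τ β, signSum β j ≤ 0 := fun j hj => by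
      have hj' : j < Nat.find (hex β hβ) := by simpa [τ, hβ] using hj
      exact not_lt.1 (Nat.find_min (hex β hβ) hj')
    refine ⟨le_antisymm ?_ hspec, hmin⟩
    have hne : τ β ≠ 0 := fun h0 => by
      rw [h0, signSum_zero] at hspec
      exact lt_irrefl _ hspec
    obtain ⟨t, ht⟩ : ∃ t, τ β = t + 1 := ⟨τ β - 1, by omega⟩
    have h1 := hmin t (by omega)
    have h2 := signSum_succ_le β t
    rw [ht]
    omega
  have hτk : ∀ β ∈ A, τ β ≤ k := by
    intro β hβ
    by_contra h
    have h1 := (hτ β hβ).1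
    rw [signSum_of_le β (le_of_lt (not_le.1 h))] at h1
    have h2 := ((hmemA β).1 hβ).2
    omega
  -- the reflection maps `A` into `B` …
  have hmaps : ∀ β ∈ A, reflectAfter β (τ β) ∈ B := by
    intro β hβ
    have h1 := (hτ β hβ).1
    have h2 := ((hmemA β).1 hβ).2
    have hadd := signSum_reflectAfter_add β (hτk β hβ)
    simp only [hB, Finset.mem_filter, Finset.mem_univ, true_and]
    omega
  -- … injectively: the first passage time is read off the image
  have key : ∀ β₁ ∈ A, ∀ β₂ ∈ A,
      reflectAfter β₁ (τ β₁) = reflectAfter β₂ (τ β₂) → τ β₁ ≤ τ β₂ := by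
    intro β₁ h₁ β₂ h₂ hΦ
    by_contra hlt
    have hlt : τ β₂ < τ β₁ := not_le.1 hlt
    have e1 : signSum (reflectAfter β₂ (τ β₂)) (τ β₂) = signSum β₂ (τ β₂) :=
      signSum_reflectAfter_of_le β₂ le_rfl
    have e2 : signSum (reflectAfter β₁ (τ β₁)) (τ β₂) = signSum β₁ (τ β₂) :=
      signSum_reflectAfter_of_le β₁ hlt.le
    have h3 := (hτ β₁ h₁).2 (τ β₂) hlt
    have h4 := (hτ β₂ h₂).1
    rw [← e2, hΦ, e1] at h3
    omega
  have hinj : Set.InjOn (fun β => reflectAfter β (τ β)) A := by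
    intro β₁ h₁ β₂ h₂ hΦ
    have h₁' : β₁ ∈ A := by simpa using h₁
    have h₂' : β₂ ∈ A := by simpa using h₂
    have hττ : τ β₁ = τ β₂ := le_antisymm (key β₁ h₁' β₂ h₂' hΦ) (key β₂ h₂' β₁ h₁' hΦ.symm)
    calc β₁ = reflectAfter (reflectAfter β₁ (τ β₁)) (τ β₁) :=
          (reflectAfter_reflectAfter β₁ (τ β₁)).symm
      _ = reflectAfter (reflectAfter β₂ (τ β₂)) (τ β₂) := by
          show reflectAfter ((fun β => reflectAfter β (τ β)) β₁) (τ β₁) =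
            reflectAfter ((fun β => reflectAfter β (τ β)) β₂) (τ β₂)
          rw [hΦ, hττ]
      _ = β₂ := reflectAfter_reflectAfter β₂ (τ β₂)
  exact Finset.card_le_card_of_injOn (fun β => reflectAfter β (τ β)) (fun β hβ => hmaps β hβ) hinj

/-- Negating all steps: as many paths end at a level `≥ 2` as at a level `≤ -2`. [folklore] -/
theorem card_filter_two_le_signSum_eq (k : ℕ) :
    #{β : Fin k → Bool | 2 ≤ signSum β k} = #{β : Fin k → Bool | signSum β k ≤ -2} := by
  refine Finset.card_bijective (fun β i => !β i)
    (Function.Involutive.bijective fun β => by funext i; simp) fun β => ?_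
  simp only [Finset.mem_filter, Finset.mem_univ, true_and, signSum_not]
  omega

/-- The Boolean step sequences of length `k` with exactly `m` up-steps are counted by the
binomial coefficient `C(k, m)` (they correspond to the `m`-subsets of `Fin k`). [folklore] -/
theorem card_filter_card_upSteps_eq (k m : ℕ) :
    #{β : Fin k → Bool | (Finset.univ.filter fun i => β i = true).card = m} = k.choose m := by
  have h : #(Finset.powersetCard m (Finset.univ : Finset (Fin k))) = k.choose m := by
    rw [Finset.card_powersetCard, Finset.card_univ, Fintype.card_fin]
  rw [← h]
  refine Finset.card_nbij' (fun β => Finset.univ.filter fun i => β i = true)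
    (fun s i => decide (i ∈ s)) ?_ ?_ ?_ ?_
  · intro β hβ
    have hβ' := (Finset.mem_filter.1 (Finset.mem_coe.1 hβ)).2
    exact Finset.mem_coe.2 (Finset.mem_powersetCard.2 ⟨Finset.subset_univ _, hβ'⟩)
  · intro s hs
    have hs' := (Finset.mem_powersetCard.1 (Finset.mem_coe.1 hs)).2
    refine Finset.mem_coe.2 (Finset.mem_filter.2 ⟨Finset.mem_univ _, ?_⟩)
    convert hs' using 2
    ext i
    simp
  · intro β _
    funext i
    simp
  · intro s _
    ext i
    simp

open Classical in
/-- **Ballot bound by the reflection principle**: at least `C(k, ⌊k/2⌋)` of the `2^k` paths of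
length `k` with steps `±1` have all their partial sums `≤ 0`. Indeed the complement (maximum
`≥ 1`) splits according to the sign of the final value; the part ending `≥ 1` is at most
`#{S_k ≥ 1}`, the part ending `≤ 0` is at most `#{S_k ≥ 2} = #{S_k ≤ -2}` by reflection
(`card_filter_max_pos_and_le_zero_le`), and what is left, `#{S_k ∈ {0, -1}}`, is the number of
paths with exactly `⌊k/2⌋` up-steps. (With the converse inclusion this is the classical identity
`#{max ≤ 0} = C(k, ⌊k/2⌋)`; only the inequality is needed here.) [folklore] -/
theorem choose_half_le_card_filter_signSum_le_zero (k : ℕ) :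
    k.choose (k / 2) ≤ #{β : Fin k → Bool | ∀ j ≤ k, signSum β j ≤ 0} := by
  -- complement: `b + #{max ≥ 1} = 2^k`
  have hcompl : #{β : Fin k → Bool | ∀ j ≤ k, signSum β j ≤ 0} +
      #{β : Fin k → Bool | ∃ j ≤ k, 0 < signSum β j} = 2 ^ k := by
    have h := Finset.card_filter_add_card_filter_not
      (s := (Finset.univ : Finset (Fin k → Bool))) (fun β => ∀ j ≤ k, signSum β j ≤ 0)
    rw [Finset.card_univ, Fintype.card_fun, Fintype.card_bool, Fintype.card_fin] at h
    rw [← h]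
    congr 2
    refine Finset.filter_congr fun β _ => ?_
    simp only [not_forall, not_le, exists_prop]
  -- split `{max ≥ 1}` by the sign of the final value, and reflect the second part
  have hsplit : #{β : Fin k → Bool | ∃ j ≤ k, 0 < signSum β j} ≤
      #{β : Fin k → Bool | 0 < signSum β k} + #{β : Fin k → Bool | signSum β k ≤ -2} := by
    calc #{β : Fin k → Bool | ∃ j ≤ k, 0 < signSum β j}
        ≤ #{β : Fin k → Bool | (∃ j ≤ k, 0 < signSum β j) ∧ 0 < signSum β k} +
            #{β : Fin k → Bool | (∃ j ≤ k, 0 < signSum β j) ∧ signSum β k ≤ 0} := by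
          rw [Finset.card_filter, Finset.card_filter, Finset.card_filter, ← Finset.sum_add_distrib]
          refine Finset.sum_le_sum fun β _ => ?_
          by_cases hM : ∃ j ≤ k, 0 < signSum β j
          · by_cases hk : 0 < signSum β k
            · rw [if_pos hM, if_pos (show (∃ j ≤ k, 0 < signSum β j) ∧ 0 < signSum β k from
                ⟨hM, hk⟩)]
              exact Nat.le_add_right _ _
            · rw [if_pos hM, if_pos (show (∃ j ≤ k, 0 < signSum β j) ∧ signSum β k ≤ 0 from
                ⟨hM, not_lt.1 hk⟩)]
              exact Nat.le_add_left _ _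
          · rw [if_neg hM]
            exact Nat.zero_le _
      _ ≤ #{β : Fin k → Bool | 0 < signSum β k} + #{β : Fin k → Bool | 2 ≤ signSum β k} := by
          refine add_le_add (Finset.card_le_card fun β hβ => ?_)
            (card_filter_max_pos_and_le_zero_le k)
          simp only [Finset.mem_filter, Finset.mem_univ, true_and] at hβ ⊢
          exact hβ.2
      _ = #{β : Fin k → Bool | 0 < signSum β k} + #{β : Fin k → Bool | signSum β k ≤ -2} := by
          rw [card_filter_two_le_signSum_eq]
  -- the three-way partition of all paths by their final value
  have hpart : #{β : Fin k → Bool | 0 < signSum β k} + #{β : Fin k → Bool | signSum β k ≤ -2} +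
      #{β : Fin k → Bool | -1 ≤ signSum β k ∧ signSum β k ≤ 0} = 2 ^ k := by
    rw [Finset.card_filter, Finset.card_filter, Finset.card_filter, ← Finset.sum_add_distrib,
      ← Finset.sum_add_distrib]
    rw [Finset.sum_congr rfl fun β _ => show ((if 0 < signSum β k then 1 else 0) +
        (if signSum β k ≤ -2 then 1 else 0) +
        (if -1 ≤ signSum β k ∧ signSum β k ≤ 0 then 1 else 0) : ℕ) = 1 by
          split_ifs <;> omega]
    simp
  -- the middle class: exactly `⌊k/2⌋` up-steps
  have hmid : #{β : Fin k → Bool | -1 ≤ signSum β k ∧ signSum β k ≤ 0} = k.choose (k / 2) := by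
    rw [← card_filter_card_upSteps_eq k (k / 2)]
    congr 1
    refine Finset.filter_congr fun β _ => ?_
    rw [signSum_self_eq]
    omega
  generalize (2 : ℕ) ^ k = N at hcompl hpart
  omega

end SignedPaths

/-! ### The central binomial coefficient: `4^k ≤ 2(k+1) C(k, ⌊k/2⌋)²` -/

/-- `16^m ≤ 4m · C(2m,m)²` for `m ≥ 1` (induction with `(m+1) C(2m+2,m+1) = 2(2m+1) C(2m,m)`
and `4m(m+1) ≤ (2m+1)²`); restates
`Literature.Barriers.CriticalPhenomena.Edwards2D.sixteen_pow_le_mul_centralBinom_sq` (see the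
design notes in the module docstring). [folklore] -/
theorem sixteen_pow_le_four_mul_mul_centralBinom_sq {m : ℕ} (hm : 1 ≤ m) :
    16 ^ m ≤ 4 * m * m.centralBinom ^ 2 := by
  induction m, hm using Nat.le_induction with
  | base => decide
  | succ i _ ih =>
      have hrec := Nat.succ_mul_centralBinom_succ i
      refine Nat.le_of_mul_le_mul_left ?_ (Nat.succ_pos i)
      have h1 : (i + 1) * (4 * (i + 1) * Nat.centralBinom (i + 1) ^ 2) =
          4 * ((i + 1) * Nat.centralBinom (i + 1)) ^ 2 := by ring
      rw [h1, hrec]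
      calc (i + 1) * 16 ^ (i + 1) = 16 * (i + 1) * 16 ^ i := by ring
        _ ≤ 16 * (i + 1) * (4 * i * Nat.centralBinom i ^ 2) := Nat.mul_le_mul_left _ ih
        _ = 16 * (4 * (i * (i + 1))) * Nat.centralBinom i ^ 2 := by ring
        _ ≤ 16 * (2 * i + 1) ^ 2 * Nat.centralBinom i ^ 2 := by
            refine Nat.mul_le_mul_right _ (Nat.mul_le_mul_left _ ?_)
            nlinarith
        _ = 4 * (2 * (2 * i + 1) * Nat.centralBinom i) ^ 2 := by ring

/-- **`4^k ≤ 2(k+1) · C(k, ⌊k/2⌋)²`** for every `k`: the middle binomial coefficient is at least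
`2^k / √(2(k+1))`. [folklore] -/
theorem four_pow_le_mul_choose_half_sq (k : ℕ) : 4 ^ k ≤ 2 * (k + 1) * k.choose (k / 2) ^ 2 := by
  obtain ⟨m, rfl | rfl⟩ := Nat.even_or_odd' k
  · -- `k = 2m`
    rcases Nat.eq_zero_or_pos m with rfl | hm
    · decide
    · have h := sixteen_pow_le_four_mul_mul_centralBinom_sq hm
      rw [Nat.centralBinom_eq_two_mul_choose] at h
      have hdiv : 2 * m / 2 = m := by omega
      rw [hdiv, pow_mul, show (4 : ℕ) ^ 2 = 16 by norm_num]
      calc 16 ^ m ≤ 4 * m * (2 * m).choose m ^ 2 := h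
        _ ≤ 2 * (2 * m + 1) * (2 * m).choose m ^ 2 := Nat.mul_le_mul_right _ (by omega)
  · -- `k = 2m + 1`: `C(2m+2, m+1) = 2 C(2m+1, m)`
    have h := sixteen_pow_le_four_mul_mul_centralBinom_sq (show 1 ≤ m + 1 by omega)
    have hcb : (m + 1).centralBinom = 2 * (2 * m + 1).choose m := by
      rw [Nat.centralBinom_eq_two_mul_choose, show 2 * (m + 1) = (2 * m + 1) + 1 by ring,
        Nat.choose_succ_succ', Nat.choose_symm_half]
      omega
    have hdiv : (2 * m + 1) / 2 = m := by omega
    rw [hdiv]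
    rw [hcb] at h
    have h16 : 4 ^ (2 * m + 1) * 4 = 16 ^ (m + 1) := by
      rw [← pow_succ, show 2 * m + 1 + 1 = 2 * (m + 1) by ring, pow_mul]
      norm_num
    refine Nat.le_of_mul_le_mul_right ?_ (show 0 < 4 by norm_num)
    calc 4 ^ (2 * m + 1) * 4 = 16 ^ (m + 1) := h16
      _ ≤ 4 * (m + 1) * (2 * (2 * m + 1).choose m) ^ 2 := h
      _ = 2 * (2 * m + 1 + 1) * (2 * m + 1).choose m ^ 2 * 4 := by ring

/-! ### Planar walks in the half-plane `{x + y ≤ 0}` -/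

section Planar

variable {k : ℕ}

/-- **The diagonal coordinate of a planar walk is a `±1` walk**: `ω(j)₀ + ω(j)₁ = S_β(j)` where
`β` is the sequence of orientation bits of the steps (`e_a ↦ +1`, `-e_a ↦ -1`, whatever the axis
`a`). [folklore] -/
theorem pos_apply_zero_add_pos_apply_one (ω : StepSeq 2 k) (j : ℕ) :
    pos ω j 0 + pos ω j 1 = signSum (fun i => (ω i).2) j := by
  unfold pos signSum
  rw [Finset.sum_apply, Finset.sum_apply, ← Finset.sum_add_distrib]
  refine Finset.sum_congr rfl fun i _ => ?_
  by_cases h : (i : ℕ) < j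
  · rw [if_pos h, if_pos h]
    have hs := sum_stepVec_apply (ω i)
    rw [Fin.sum_univ_two] at hs
    exact hs
  · simp [h]

/-- A step sequence is determined by its positions. [folklore] -/
theorem eq_of_pos_eq {d : ℕ} {ω ω' : StepSeq d k} (h : ∀ j ≤ k, pos ω j = pos ω' j) : ω = ω' := by
  funext i
  apply stepVec_injective
  have e1 := h (i + 1) i.isLt
  rw [pos_succ ω i.isLt, pos_succ ω' i.isLt, h i i.isLt.le] at e1
  exact add_left_cancel e1

/-- A step sequence is determined by the vertex list of the walk it traces. [folklore] -/
theorem eq_of_support_toWalk_eq {d : ℕ} {ω ω' : StepSeq d k}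
    (h : (toWalk ω).support = (toWalk ω').support) : ω = ω' := by
  rw [support_toWalk, support_toWalk] at h
  exact eq_of_pos_eq fun j hj => List.map_inj_left.1 h j (List.mem_range.2 (Nat.lt_succ_of_le hj))

open Classical in
/-- **The axis of each step is free**: a constraint on the orientation bits only is satisfied by
`2^k` times as many planar step sequences as Boolean sequences. [folklore] -/
theorem card_filter_stepSeq_snd (k : ℕ) (P : (Fin k → Bool) → Prop) [DecidablePred P] :
    #{ω : StepSeq 2 k | P (fun i => (ω i).2)} = 2 ^ k * #{β : Fin k → Bool | P β} := by
  rw [Finset.card_equiv (Equiv.arrowProdEquivProdArrow (Fin k) (fun _ => Fin 2) (fun _ => Bool))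
      (t := (Finset.univ : Finset (Fin k → Fin 2)) ×ˢ
        (Finset.univ.filter fun β : Fin k → Bool => P β)) ?_]
  · rw [Finset.card_product, Finset.card_univ, Fintype.card_fun, Fintype.card_fin,
      Fintype.card_fin]
  · intro ω
    simp [Equiv.arrowProdEquivProdArrow]

/-- The point reflection `x ↦ e₁ - x` of `ℤ²` through the midpoint of the edge `{0, e₁}` is a
graph homomorphism of the nearest-neighbour graph (indeed an automorphism; it exchanges `0` and
`e₁` and maps `{x + y ≤ 0}` onto `{x + y ≥ 1}`). [folklore] -/
def antipode : zdGraph 2 →g zdGraph 2 where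
  toFun x := e₁ - x
  map_rel' := by
    intro x y h
    obtain ⟨i, h | h⟩ := (zdGraph_adj_iff x y).1 h
    · exact (zdGraph_adj_iff _ _).2 ⟨i, Or.inr (by rw [h]; abel)⟩
    · exact (zdGraph_adj_iff _ _).2 ⟨i, Or.inl (by rw [h]; abel)⟩

/-- `antipode x = e₁ - x`. [folklore] -/
@[simp] theorem antipode_apply (x : Site 2) : antipode x = e₁ - x := rfl

/-- The point reflection is injective. [folklore] -/
theorem antipode_injective : Function.Injective antipode := fun x y h => by
  simpa using h

open Classical in
/-- **Two half-planes.** `N(k) ≥ (#{k-step walks from 0 staying in {x + y ≤ 0}})²`: pair such a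
walk `ω₁` from `0` with the point reflection `e₁ - ω₂` of another one, a `k`-step walk from `e₁`
staying in `{x + y ≥ 1}`; the two vertex sets are disjoint, and the pairing is injective into
the index set of `nonIntersectingPairs_eq_card_filter`. [folklore] -/
theorem sq_card_filter_le_nonIntersectingPairs (k : ℕ) :
    #{ω : StepSeq 2 k | ∀ j ≤ k, pos ω j 0 + pos ω j 1 ≤ 0} ^ 2 ≤ nonIntersectingPairs k := by
  set S : Finset (StepSeq 2 k) := {ω | ∀ j ≤ k, pos ω j 0 + pos ω j 1 ≤ 0} with hS
  have hmemS : ∀ ω, ω ∈ S ↔ ∀ j ≤ k, pos ω j 0 + pos ω j 1 ≤ 0 := fun ω => by simp [hS]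
  -- the two embeddings into the index sets of walks from `0` and from `e₁`
  let ι₁ : StepSeq 2 k → Σ v : Site 2, (zdGraph 2).Walk (0 : Site 2) v :=
    fun ω => ⟨endpoint ω, toWalk ω⟩
  have h0 : antipode (0 : Site 2) = e₁ := by simp
  let ι₂ : StepSeq 2 k → Σ w : Site 2, (zdGraph 2).Walk e₁ w :=
    fun ω => ⟨antipode (endpoint ω), ((toWalk ω).map antipode).copy h0 rfl⟩
  have hι₁ : Function.Injective ι₁ := fun ω ω' h =>
    eq_of_support_toWalk_eq
      (congrArg (fun s : Σ v : Site 2, (zdGraph 2).Walk (0 : Site 2) v => s.2.support) h)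
  have hι₂ : Function.Injective ι₂ := fun ω ω' h => by
    have h' := congrArg (fun s : Σ w : Site 2, (zdGraph 2).Walk e₁ w => s.2.support) h
    simp only [ι₂, Walk.support_copy, Walk.support_map] at h'
    exact eq_of_support_toWalk_eq (List.map_injective_iff.2 antipode_injective h')
  rw [nonIntersectingPairs_eq_card_filter, sq, ← Finset.card_product S S,
    ← Finset.card_image_of_injective (S ×ˢ S) (hι₁.prodMap hι₂)]
  refine Finset.card_le_card fun x hx => ?_
  rw [Finset.mem_image] at hx
  obtain ⟨⟨ω₁, ω₂⟩, hω, rfl⟩ := hx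
  obtain ⟨h₁, h₂⟩ := Finset.mem_product.1 hω
  dsimp only at h₁ h₂
  rw [hmemS] at h₁ h₂
  simp only [Prod.map_apply, Finset.mem_filter, Finset.mem_product, Finset.mem_sigma]
  refine ⟨⟨⟨endpoint_mem_box ω₁, mem_finsetWalkLength_iff.2 (length_toWalk ω₁)⟩, ⟨?_, ?_⟩⟩, ?_⟩
  · -- the reflected endpoint lies in `box 2 (k + 1)`
    have hb := endpoint_mem_box ω₂
    rw [mem_box] at hb ⊢
    intro i
    obtain ⟨hl, hu⟩ := hb i
    have he := abs_le.1 (abs_e₁_apply_le i)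
    simp only [ι₂, antipode_apply, Pi.sub_apply]
    push_cast
    constructor <;> linarith [he.1, he.2]
  · simp only [ι₂]
    rw [mem_finsetWalkLength_iff, Walk.length_copy, Walk.length_map, length_toWalk]
  · -- disjointness: `x + y ≤ 0` on the first walk, `x + y ≥ 1` on the second
    rw [Finset.disjoint_left]
    intro x hx₁ hx₂
    simp only [ι₁, List.mem_toFinset, support_toWalk, List.mem_map] at hx₁
    obtain ⟨j, hj, rfl⟩ := hx₁
    simp only [ι₂, List.mem_toFinset, Walk.support_copy, Walk.support_map, support_toWalk,
      List.map_map, List.mem_map] at hx₂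
    obtain ⟨j', hj', hjj⟩ := hx₂
    have a := h₁ j (Nat.le_of_lt_succ (List.mem_range.1 hj))
    have b := h₂ j' (Nat.le_of_lt_succ (List.mem_range.1 hj'))
    have c := congrArg (fun x : Site 2 => x 0 + x 1) hjj
    simp only [Function.comp_apply, antipode_apply, Pi.sub_apply, e₁_apply_zero,
      e₁_apply_one] at c
    omega

/-- **`N(k) ≥ 4^k · C(k, ⌊k/2⌋)²`**: the two-half-planes bound with the walks in a half-plane
counted by the ballot bound. [folklore] -/
theorem four_pow_mul_choose_sq_le_nonIntersectingPairs (k : ℕ) :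
    4 ^ k * k.choose (k / 2) ^ 2 ≤ nonIntersectingPairs k := by
  classical
  calc 4 ^ k * k.choose (k / 2) ^ 2 = (2 ^ k * k.choose (k / 2)) ^ 2 := by
        rw [mul_pow, ← pow_mul, mul_comm k 2, pow_mul]
        norm_num
    _ ≤ (2 ^ k * #{β : Fin k → Bool | ∀ j ≤ k, signSum β j ≤ 0}) ^ 2 :=
        Nat.pow_le_pow_left
          (Nat.mul_le_mul_left _ (choose_half_le_card_filter_signSum_le_zero k)) 2
    _ = #{ω : StepSeq 2 k | ∀ j ≤ k, pos ω j 0 + pos ω j 1 ≤ 0} ^ 2 := by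
        rw [← card_filter_stepSeq_snd k (fun β => ∀ j ≤ k, signSum β j ≤ 0)]
        congr 2
        refine Finset.filter_congr fun ω _ => ?_
        simp only [pos_apply_zero_add_pos_apply_one]
    _ ≤ nonIntersectingPairs k := sq_card_filter_le_nonIntersectingPairs k

end Planar

/-! ### The lower bound `N(k)/16^k ≥ 1/(2(k+1))` -/

/-- **`16^k ≤ 2(k+1) · N(k)`**: the probability that two independent `k`-step simple random walks
from neighbouring vertices of `ℤ²` do not intersect is at least `1/(2(k+1))` (two half-planes +
ballot bound + `4^k ≤ 2(k+1) C(k,⌊k/2⌋)²`). [folklore] -/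
theorem sixteen_pow_le (k : ℕ) : 16 ^ k ≤ 2 * (k + 1) * nonIntersectingPairs k :=
  calc 16 ^ k = 4 ^ k * 4 ^ k := by rw [← mul_pow]; norm_num
    _ ≤ 4 ^ k * (2 * (k + 1) * k.choose (k / 2) ^ 2) :=
        Nat.mul_le_mul_left _ (four_pow_le_mul_choose_half_sq k)
    _ = 2 * (k + 1) * (4 ^ k * k.choose (k / 2) ^ 2) := by ring
    _ ≤ 2 * (k + 1) * nonIntersectingPairs k :=
        Nat.mul_le_mul_left _ (four_pow_mul_choose_sq_le_nonIntersectingPairs k)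

/-- **`1/(2(k+1)) ≤ N(k)/16^k`** for every `k`. [folklore] -/
theorem inv_le_nonIntersectingPairs_div (k : ℕ) :
    (2 * ((k : ℝ) + 1))⁻¹ ≤ (nonIntersectingPairs k : ℝ) / 16 ^ k := by
  have h : (16 : ℝ) ^ k ≤ 2 * ((k : ℝ) + 1) * nonIntersectingPairs k := by
    exact_mod_cast sixteen_pow_le k
  rw [inv_eq_one_div, div_le_div_iff₀ (by positivity) (by positivity), one_mul]
  linarith

/-- **The lower half of the Lawler–Schramm–Werner display with exponent `1` in place of `5/8`**
(the elementary half-plane bound `ζ₂ ≤ 1`): for some `c > 0`,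
`c · k^{-1} ≤ P[S[0,k] ∩ S'[0,k] = ∅] = N(k)/16^k` for all `k ≥ 1` (here `c = 1/4`). This is NOT
the vendored fact `LSW2001_srw_nonIntersection_five_eighths`, whose exponent `5/8` on both sides
rests on `ξ(1,1) = 5/4` [LSW 2001, Thm. 13] and Lawler 1996, Thm. 1.3. [folklore] -/
theorem exists_const_mul_rpow_neg_one_le :
    ∃ c : ℝ, 0 < c ∧ ∀ k : ℕ, 1 ≤ k →
      c * (k : ℝ) ^ (-(1 : ℝ)) ≤ (nonIntersectingPairs k : ℝ) / 16 ^ k := by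
  refine ⟨1 / 4, by norm_num, fun k hk => ?_⟩
  have hk' : (1 : ℝ) ≤ k := by exact_mod_cast hk
  rw [Real.rpow_neg (by positivity), Real.rpow_one]
  calc 1 / 4 * ((k : ℝ))⁻¹ = (4 * (k : ℝ))⁻¹ := by rw [mul_inv, one_div]
    _ ≤ (2 * ((k : ℝ) + 1))⁻¹ := by
        apply inv_anti₀ (by positivity)
        linarith
    _ ≤ (nonIntersectingPairs k : ℝ) / 16 ^ k := inv_le_nonIntersectingPairs_div k

end PlaneNonIntersection

end Literature.Probability.RandomPlanarGeometry

end
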